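import Mathlib
import Summits.Ventures.DiscreteObjects.Mahler.DobrowolskiTheorem

/-!
# Corollaries of Dobrowolski's theorem: the constant `1/2000` at large degree; the number of factors of measure `> 1` (venture `DiscreteObjects`, target L)

Cell `pub-namedobj`, seat `pub-namedobj-mahler-g27`. Framing: lottery ticket; floor = certified bounds/negative ranges.

Two corollaries of Dobrowolski's theorem [cite: MckeeSmyth2021, Theorem 3.1] (`DobrowolskiTheorem.dobrowolski`,
`DobrowolskiAsymptotics.dobrowolski_of_nondegenerate`).  (A) The printed form "for `d ≥ d₀`" with an explicit constant:
**there is `D` such that every monic irreducible `f ∈ ℤ[X]` with `M(f) > 1` and `deg f = d ≥ D` has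
`M(f) ≥ 1 + (1/2000)(log log d / log d)³`** (`dobrowolski_explicit`; the degenerate descent of Lemma 3.8 keeps the constant of
the nondegenerate case because the shape is decreasing from `16` on and small degrees carry the weak bound `1/(22d)`).
(B) In the direction of the title of Dobrowolski's paper (Acta Arith. 34 (1979), "… and the number of irreducible factors of a
polynomial"): a uniform per-factor bound `log M(g) ≥ c (log log D / log D)³` for every irreducible `g ∈ ℤ[X]` with
`M(g) > 1` and `deg g ≤ D` (`exists_log_measure_ge_shape`), whence **for every nonzero `P ∈ ℤ[X]` of degree `D`, the
number `k` of irreducible factors of `P` of Mahler measure `> 1` (with multiplicity; i.e. the non-cyclotomic factors other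
than `±X`, and the constants `±a`, `|a| ≥ 2`) satisfies `k · c (log log D / log D)³ ≤ log M(P)`**
(`dobrowolski_factor_count`).  Our formulation; the constant is the unspecified one of `dobrowolski`.  No new mathematics.
-/

namespace Summit.Ventures.DiscreteObjects.Mahler

open Polynomial

/-- **Uniform per-factor bound.**  There is `c > 0` such that every irreducible `g ∈ ℤ[X]` with `M(g) > 1` and
`deg g ≤ D` has `log M(g) ≥ c (log log D / log D)³` (Dobrowolski's theorem for `deg g ≥ 16`, where the shape is
decreasing; the weak bound `1 + 1/(22 deg g)` below). -/
theorem exists_log_measure_ge_shape : ∃ c : ℝ, 0 < c ∧ ∀ g : ℤ[X], Irreducible g → 1 < intMahlerMeasure g →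
    ∀ D : ℕ, g.natDegree ≤ D →
      c * (Real.log (Real.log D) / Real.log D) ^ 3 ≤ Real.log (intMahlerMeasure g) := by
  -- `x/2 ≤ log (1 + x)` for `0 ≤ x ≤ 1` (also `Literature.NumberTheory.LFunctions.MaynardPratt.half_le_log_one_add`)
  have half_le_log_one_add : ∀ {x : ℝ}, 0 ≤ x → x ≤ 1 → x / 2 ≤ Real.log (1 + x) := by
    intro x hx0 hx1
    have h := Real.one_sub_inv_le_log_of_pos (show 0 < 1 + x by linarith)
    have : x / 2 ≤ 1 - (1 + x)⁻¹ := by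
      rw [show 1 - (1 + x)⁻¹ = x / (1 + x) by field_simp; ring]
      exact div_le_div_of_nonneg_left hx0 (by linarith) (by linarith)
    linarith
  obtain ⟨c₁, hc₁, hc⟩ := dobrowolski_of_irreducible
  set c : ℝ := min (min c₁ 1 / 2) (1 / 704) with hcdef
  have hcpos : 0 < c := lt_min (by positivity) (by norm_num)
  have hcle1 : c ≤ min c₁ 1 / 2 := min_le_left _ _
  have hcle2 : c ≤ 1 / 704 := min_le_right _ _
  refine ⟨c, hcpos, fun g hgirr hMg D hgD => ?_⟩
  set φ := (Real.log (Real.log D) / Real.log D) ^ 3 with hφ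
  have hφ1 : φ ≤ 1 := dobrowolskiShape_le_one D
  have hlogM : 0 < Real.log (intMahlerMeasure g) := Real.log_pos hMg
  rcases le_or_gt φ 0 with hφ0 | hφ0
  · have : c * φ ≤ 0 := mul_nonpos_of_nonneg_of_nonpos hcpos.le hφ0
    linarith
  by_cases hgd : 16 ≤ g.natDegree
  · -- Dobrowolski's theorem at `deg g`, transported to `D` by monotonicity
    have hb := hc g hgirr hMg
    have hmono := dobrowolskiShape_antitone hgd hgD
    set x := min c₁ 1 * φ with hx
    have hx0 : 0 ≤ x := mul_nonneg (lt_min hc₁ one_pos).le hφ0.le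
    have hx1 : x ≤ 1 := by
      calc x ≤ 1 * φ := mul_le_mul_of_nonneg_right (min_le_right _ _) hφ0.le
        _ ≤ 1 := by linarith
    have hxM : 1 + x ≤ intMahlerMeasure g := by
      have h1 : x ≤ c₁ * φ := mul_le_mul_of_nonneg_right (min_le_left _ _) hφ0.le
      have h2 : c₁ * φ ≤ c₁ * (Real.log (Real.log g.natDegree) / Real.log g.natDegree) ^ 3 :=
        mul_le_mul_of_nonneg_left hmono hc₁.le
      linarith
    have h3 := half_le_log_one_add hx0 hx1
    have h4 : Real.log (1 + x) ≤ Real.log (intMahlerMeasure g) := Real.log_le_log (by linarith) hxM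
    have h5 : c * φ ≤ x / 2 := by
      rw [hx]
      have := mul_le_mul_of_nonneg_right hcle1 hφ0.le
      linarith
    linarith
  · -- small degree: the weak bound gives `M(g) ≥ 1 + 1/352`
    push Not at hgd
    have hw := weakDobrowolski_of_irreducible hgirr hMg
    have hM352 : 1 + 1 / (352 : ℝ) ≤ intMahlerMeasure g := by
      rcases Nat.eq_zero_or_pos g.natDegree with hd0 | hdpos
      · have hgC : g = C (g.coeff 0) := eq_C_of_natDegree_eq_zero hd0
        have h2 : (2 : ℝ) ≤ intMahlerMeasure g := by
          rw [hgC, intMahlerMeasure_C] at hMg ⊢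
          have h1 : (1 : ℤ) < |g.coeff 0| := by exact_mod_cast hMg
          have : (2 : ℤ) ≤ |g.coeff 0| := h1
          exact_mod_cast this
        linarith
      · have h1 : 1 / (352 : ℝ) ≤ 1 / (22 * (g.natDegree : ℝ)) := by
          apply one_div_le_one_div_of_le (by positivity)
          have : (g.natDegree : ℝ) ≤ 16 := by exact_mod_cast hgd.le
          linarith
        linarith
    have h3 := half_le_log_one_add (show (0 : ℝ) ≤ 1 / 352 by norm_num) (by norm_num)
    have h4 : Real.log (1 + 1 / 352) ≤ Real.log (intMahlerMeasure g) := Real.log_le_log (by norm_num) hM352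
    have h5 : c * φ ≤ c * 1 := mul_le_mul_of_nonneg_left hφ1 hcpos.le
    linarith

open scoped Classical in
/-- **The number of irreducible factors of measure `> 1`** (Dobrowolski 1979, title application; our formulation):
there is `c > 0` such that for every nonzero `P ∈ ℤ[X]` of degree `D`, the number `k` of irreducible factors of `P` of
Mahler measure `> 1`, counted with multiplicity, satisfies `k · c · (log log D / log D)³ ≤ log M(P)`. -/
theorem dobrowolski_factor_count : ∃ c : ℝ, 0 < c ∧ ∀ P : ℤ[X], P ≠ 0 →
    (((UniqueFactorizationMonoid.factors P).filter (fun g => 1 < intMahlerMeasure g)).card : ℝ) *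
        (c * (Real.log (Real.log P.natDegree) / Real.log P.natDegree) ^ 3) ≤ Real.log (intMahlerMeasure P) := by
  obtain ⟨c, hcpos, hc⟩ := exists_log_measure_ge_shape
  refine ⟨c, hcpos, fun P hP => ?_⟩
  set F := UniqueFactorizationMonoid.factors P with hF
  set F₁ := F.filter (fun g => 1 < intMahlerMeasure g) with hF₁
  set φ := (Real.log (Real.log P.natDegree) / Real.log P.natDegree) ^ 3 with hφ
  set E := Real.exp (c * φ) with hE
  obtain ⟨u, hu⟩ := UniqueFactorizationMonoid.factors_prod hP
  obtain ⟨k, hk, hku⟩ := Polynomial.isUnit_iff.mp u.isUnit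
  have hFirr : ∀ f ∈ F, Irreducible f := fun f hf => UniqueFactorizationMonoid.irreducible_of_factor f hf
  have hMu : intMahlerMeasure (↑u : ℤ[X]) = 1 := by
    rw [← hku, intMahlerMeasure_C]
    rcases Int.isUnit_iff.mp hk with h | h <;> simp [h]
  have hMp : intMahlerMeasure P = (F.map intMahlerMeasure).prod := by
    rw [← hu, intMahlerMeasure_mul, hMu, mul_one, intMahlerMeasure_multiset_prod]
  have hdvd : ∀ f ∈ F, f ∣ P := fun f hf => (Multiset.dvd_prod hf).trans ⟨↑u, hu.symm⟩
  have hge1 : ∀ f ∈ F, 1 ≤ intMahlerMeasure f := fun f hf => one_le_intMahlerMeasure (hFirr f hf).ne_zero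
  -- every counted factor has measure `≥ E = exp(c φ)`
  have hEle : ∀ f ∈ F₁, E ≤ intMahlerMeasure f := by
    intro f hf
    rw [hF₁, Multiset.mem_filter] at hf
    obtain ⟨hfF, hfM⟩ := hf
    have h := hc f (hFirr f hfF) hfM P.natDegree (natDegree_le_of_dvd (hdvd f hfF) hP)
    calc E = Real.exp (c * φ) := rfl
      _ ≤ Real.exp (Real.log (intMahlerMeasure f)) := Real.exp_le_exp.2 h
      _ = intMahlerMeasure f := Real.exp_log (lt_trans zero_lt_one hfM)
  -- split the factor multiset
  have hsplit : (F.map intMahlerMeasure).prod =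
      (F₁.map intMahlerMeasure).prod * ((F.filter (fun g => ¬ 1 < intMahlerMeasure g)).map intMahlerMeasure).prod := by
    rw [← Multiset.prod_add, ← Multiset.map_add, hF₁, Multiset.filter_add_not]
  have hrest : 1 ≤ ((F.filter (fun g => ¬ 1 < intMahlerMeasure g)).map intMahlerMeasure).prod :=
    Multiset.one_le_prod (fun x hx => by
      obtain ⟨f, hf, rfl⟩ := Multiset.mem_map.1 hx
      exact hge1 f (Multiset.mem_of_mem_filter hf))
  have hE0 : 0 ≤ E := (Real.exp_pos _).le
  have hpow : E ^ F₁.card ≤ (F₁.map intMahlerMeasure).prod := by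
    calc E ^ F₁.card = (F₁.map fun _ => E).prod := by rw [Multiset.map_const', Multiset.prod_replicate]
      _ ≤ (F₁.map intMahlerMeasure).prod :=
          Multiset.prod_map_le_prod_map₀ _ _ (fun _ _ => hE0) (fun f hf => hEle f hf)
  have hprod0 : 0 ≤ (F₁.map intMahlerMeasure).prod :=
    le_trans (pow_nonneg hE0 _) hpow
  have hMP : E ^ F₁.card ≤ intMahlerMeasure P := by
    rw [hMp, hsplit]
    calc E ^ F₁.card ≤ (F₁.map intMahlerMeasure).prod * 1 := by rw [mul_one]; exact hpow
      _ ≤ _ := mul_le_mul_of_nonneg_left hrest hprod0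
  have hlog := Real.log_le_log (pow_pos (Real.exp_pos _) _) hMP
  rw [Real.log_pow, Real.log_exp] at hlog
  linarith

/-- **Dobrowolski's theorem with the explicit constant `1/2000` at large degree** ([cite: MckeeSmyth2021, Theorem 3.1]
"for `d ≥ d(ε)`"; printed constant `2 - ε` with the PNT, here Chebyshev-strength): there is `D` such that every monic
irreducible `f ∈ ℤ[X]` with `M(f) > 1` and degree `d ≥ D` satisfies `M(f) ≥ 1 + (1/2000) (log log d / log d)³`. -/
theorem dobrowolski_explicit : ∃ D : ℕ, ∀ f : ℤ[X], f.Monic → Irreducible f → 1 < intMahlerMeasure f →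
    D ≤ f.natDegree →
    1 + 1 / 2000 * (Real.log (Real.log f.natDegree) / Real.log f.natDegree) ^ 3 ≤ intMahlerMeasure f := by
  classical
  obtain ⟨U₀, hU⟩ := dobrowolski_of_nondegenerate
  set D₀ : ℕ := max 16 ⌈Real.exp U₀⌉₊ with hD₀
  have hD16 : 16 ≤ D₀ := le_max_left _ _
  have hDlog : ∀ d : ℕ, D₀ ≤ d → U₀ ≤ Real.log d := by
    intro d hd
    have h1 : Real.exp U₀ ≤ d :=
      (Nat.le_ceil _).trans (by exact_mod_cast (le_max_right 16 _).trans hd)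
    calc U₀ = Real.log (Real.exp U₀) := (Real.log_exp _).symm
      _ ≤ Real.log d := Real.log_le_log (Real.exp_pos _) h1
  have hD₀pos : (0 : ℝ) < D₀ := by exact_mod_cast lt_of_lt_of_le (by norm_num) hD16
  set b : ℝ := 1 / (22 * D₀) with hb
  have hbpos : 0 < b := by positivity
  have hb352 : b ≤ 1 / 352 := by
    rw [hb]
    apply one_div_le_one_div_of_le (by norm_num)
    have : (16 : ℝ) ≤ D₀ := by exact_mod_cast hD16
    linarith
  -- the claim for all degrees `≥ 16`, by strong induction
  have hclaim : ∀ e : ℕ, ∀ g : ℤ[X], g.natDegree = e → g.Monic → Irreducible g → 1 < intMahlerMeasure g → 16 ≤ e →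
      1 + min b (1 / 2000 * (Real.log (Real.log e) / Real.log e) ^ 3) ≤ intMahlerMeasure g := by
    intro e
    induction e using Nat.strong_induction_on with
    | _ e ih =>
      intro g hge hgmon hgirr hMg he16
      by_cases hsmall : e < D₀
      · have hw := weakDobrowolski_of_irreducible hgirr hMg
        rw [hge] at hw
        have h1 : b ≤ 1 / (22 * (e : ℝ)) := by
          rw [hb]
          apply one_div_le_one_div_of_le (by positivity)
          have : (e : ℝ) ≤ D₀ := by exact_mod_cast hsmall.le
          linarith
        have h2 := min_le_left b (1 / 2000 * (Real.log (Real.log e) / Real.log e) ^ 3)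
        linarith
      push Not at hsmall
      by_cases hnd : ∀ a ∈ (g.map (Int.castRingHom ℂ)).roots, ∀ c ∈ (g.map (Int.castRingHom ℂ)).roots, a ≠ c →
          ∀ m : ℕ, 0 < m → a ^ m ≠ c ^ m
      · have h := hU g hgmon hgirr hMg hnd (hge ▸ hDlog e hsmall)
        rw [hge] at h
        have hM0 : 0 < intMahlerMeasure g := lt_trans zero_lt_one hMg
        have hexp := Real.add_one_le_exp (Real.log (intMahlerMeasure g))
        rw [Real.exp_log hM0] at hexp
        have h2 := min_le_right b (1 / 2000 * (Real.log (Real.log e) / Real.log e) ^ 3)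
        linarith
      · push Not at hnd
        obtain ⟨a, ha, c, hc, hac, m, hm, heq⟩ := hnd
        have h0 : g.coeff 0 ≠ 0 := by
          intro h0
          have h1 := measure_eq_one_of_irreducible_of_dvd hgirr (X_dvd_iff.mpr h0) Polynomial.not_isUnit_X
            intMahlerMeasure_X
          linarith
        obtain ⟨g', hg'mon, hg'irr, -, hMg'1, hMg'le, hdeglt⟩ :=
          exists_irreducible_of_lower_degree g hgmon hgirr h0 hMg ha hc hac ⟨m, hm, heq⟩
        by_cases h16 : g'.natDegree < 16
        · -- tiny degree: the weak bound `1/(22·deg) ≥ 1/352 ≥ b`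
          have hw := weakDobrowolski_of_irreducible hg'irr hMg'1
          have hpos : 0 < g'.natDegree := natDegree_pos_of_one_lt_measure hg'mon hMg'1
          have h1 : 1 / (352 : ℝ) ≤ 1 / (22 * (g'.natDegree : ℝ)) := by
            apply one_div_le_one_div_of_le (by positivity)
            have : (g'.natDegree : ℝ) ≤ 16 := by exact_mod_cast h16.le
            linarith
          have h2 := min_le_left b (1 / 2000 * (Real.log (Real.log e) / Real.log e) ^ 3)
          linarith
        · push Not at h16
          have ih' := ih g'.natDegree (hge ▸ hdeglt) g' rfl hg'mon hg'irr hMg'1 h16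
          have hmono := dobrowolskiShape_antitone h16 (hge ▸ hdeglt.le)
          have : min b (1 / 2000 * (Real.log (Real.log e) / Real.log e) ^ 3) ≤
              min b (1 / 2000 * (Real.log (Real.log g'.natDegree) / Real.log g'.natDegree) ^ 3) :=
            min_le_min le_rfl (by linarith)
          linarith
  -- the shape tends to `0`, so for large `d` the minimum is the Dobrowolski term
  have htend : Filter.Tendsto (fun d : ℕ => 1 / 2000 * (Real.log (Real.log d) / Real.log d) ^ 3)
      Filter.atTop (nhds 0) := by
    have h1 : Filter.Tendsto (fun x : ℝ => Real.log x ^ 1 / (1 * x + 0)) Filter.atTop (nhds 0) :=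
      Real.tendsto_pow_log_div_mul_add_atTop 1 0 1 one_ne_zero
    have h2 : Filter.Tendsto (fun d : ℕ => Real.log (d : ℝ)) Filter.atTop Filter.atTop :=
      Real.tendsto_log_atTop.comp tendsto_natCast_atTop_atTop
    have h3 := h1.comp h2
    have h4 : Filter.Tendsto (fun d : ℕ => Real.log (Real.log d) / Real.log d) Filter.atTop (nhds 0) := by
      refine h3.congr fun d => ?_
      simp
    have h5 := (h4.pow 3).const_mul (1 / 2000 : ℝ)
    simpa using h5
  obtain ⟨D₁, hD₁⟩ := Filter.eventually_atTop.1 (htend.eventually (gt_mem_nhds hbpos))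
  refine ⟨max D₁ 16, fun f hmon hirr hM hd => ?_⟩
  have hd16 : 16 ≤ f.natDegree := (le_max_right _ _).trans hd
  have hdD₁ : D₁ ≤ f.natDegree := (le_max_left _ _).trans hd
  have h := hclaim f.natDegree f rfl hmon hirr hM hd16
  have hlt := hD₁ f.natDegree hdD₁
  rw [min_eq_right hlt.le] at h
  exact h

end Summit.Ventures.DiscreteObjects.Mahler
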